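import Literature.MathematicalPhysics.QuantumFieldTheory.Balaban1983to89.B2Prop31MinimizerWitness
import Literature.MathematicalPhysics.QuantumFieldTheory.Balaban1983to89.B2Eq28RegionsCollars

/-!
# `Balaban1983to89.B2Prop31MinimizerRegions` — [Balaban1982Higgs2] Proposition 3.1 (3.26) p. 589 for the family with the PRINTED minimizers
(3.3), the PRINTED restrictions (2.55), AND THE REGIONS OF (2.7)–(2.8) CONSTRUCTED FROM THE LARGE-FIELD DATA: the carrier of p23 g12's
`B2Prop31MinimizerFamilyK.RMultiMK` with the (2.44) cut-off radius at step `k` set to the cell's ruled radius (c)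
`ρ_k = 3r(L^{k−1}ε)/L − 2M − 2` (GAPS.md G-B2-12), and a CONSTRUCTOR from the typer's regions tower `B2Eq243RegionsTower` in which the
region hypotheses `nbhd` / `L2_sub` / `lam_sub` and the four (2.44) clauses are PROVED (`RegionsData.toRMultiMR`)

statement-level skeleton of published theorems with citation tags; proofs where landed; nothing here is a claim about the Yang–Mills mass gap

CITATION HEADER.  T. Bałaban, *(Higgs)₂,₃ quantum fields in a finite volume. II. An upper bound*, Commun. Math. Phys. **86** (1982)
555–594 [Balaban1982Higgs2] (PDF held `paper:balaban1982-cmp86-higgs23-ii`, journal page = PDF page + 554; pp. 558, 566, 570–571, 583, 589 on the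
×2 renders `run/shared/lean/pub/pub-balaban/b2b-balaban-ref1/pages/1982-cmp86-higgs23-II/…-p004/p012/p016/p017/p029/p035-x2.png`); part I
[Balaban1982Higgs1] (1.3) p. 604, (1.20)/(1.22) p. 607, (2.15) p. 609.  Cell `lit-balaban` (HOME `run/shared/lean/pub/lit-balaban/`), Phase-2 proof
seat **p23** gen 13 (unit `lit-balaban-p23-g13`; TAKING line HOME/STATUS.md 2026-08-22T04:49:42Z; owner r02's note 04:32:54Z).  SKELETON rows
**B2.Prop3.1** (decl of record `B2.Prop31Printed`, owner r02), **B2.Eq3.29**, **B2.Lem2.3**, **B2.Eq2.44**, **B2.Eq2.7** — CELLS ONLY, no head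
claims; second reader r14, referee ref-4.  USED BY NAME, NOTHING RESTATED: p23 g11/g12 `B2Prop31MinimizerFamily.{MinConsts, Lemma23Bounds,
exists_lemma23Bounds, bound259_le_thr259, bound260_le_thr260}` (p314111), `B2Prop31MinimizerFamilyK.RMultiMK` (p315587, the shape copied with ONE
change: the radius), `B2Prop31MinimizerWitness.{thetaW, nested_thetaW, chargeW, thrQ_nonneg}` (p315976), `B2Eq244Cutoff.{zeta244, zeta244_supp,
zeta244_eq_one, zeta244_lip, abs_zeta244_le_one, le_rFn}` (p315440), p23 g13 `B2Eq28RegionsCollars.{nbhd_radC, prime_towerRegion_two_subset,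
prime_lam_subset}` (filed p318957), the typer's `B2Eq243RegionsTower.{towerRegion, towerOf}` / `B2Eq28RegionsConcrete.near` / p15's `prime`,
p23 g10 `B2Prop31PrintedRestrictions.{RMultiP, printedP31Fam, printed329Fam, prop31Printed_thresholds, ineq329Printed_thresholds}`, `B2Prop31Thresholds.
{thr259, thr260, SmallEps, one_le_u, pFn_nonneg'}`, r14 `B2Lemma23HiggsLattice.cutMin` (p312208), b2b's `B2.{Params, rFn, Prop31Printed, Ineq329Printed}`.

WHY THIS FILE (GAPS.md **G-B2-12**, OWNER ADJUDICATION r02 g11 2026-08-22T04:40Z on r14 g13's READER NOTE; p23 gen-11 HONEST SCOPE (ii)).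
In `RMultiM`/`RMultiMK` the regions `Λ₁ ⊇ Λ₂` of each level and their three properties — `nbhd` (the range of `ζ^{(k)}` (+1) around
`Bᵏ(Λ₂)` lies in `Λ₁`, where (2.55) holds), `L2_sub`, `lam_sub` (`Λ₅ ⊂ Λ₂`) — are DATA WITH HYPOTHESES, readings of (2.7)–(2.8).  With the
(2.44) radius `r(Lᵏε)` hard-wired there, `nbhd` is NOT derivable from the printed regions for `L ≥ 4` (G-B2-12: the three (2.8)-collars between
`Λ₂^{(k−1)′}` and `(Λ₋₁^{(k−1)′})ᶜ` measure `≈ 3r(L^{k−1}ε)/L` in `T₁^{(k)}`-units).  The cell's ruling: *"CONSTANTS-ONLY REPAIR (c): step-k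
cut-off radius ρ_k := 3r(L^{k−1}ε)/L − 2M − 2 (plateau ½ρ_k) … the price — the G_kQ_k^* tail beyond ½ρ_k — is c₀e^{−δ₀ρ_k/2} = o((L^{k−1}ε)^N)
… absorbed in (2.59)–(2.60) with R enlarged"*.  THIS FILE implements exactly that: the carrier `RMultiMR` = `RMultiMK` with radius `ρ_k` (§2);
Lemma 2.3 in the threshold shape at a general radius (§1, the tail `e^{−δρ_k/2} ≤ Lᵏε` once `R ≥ (L/3)(2/δ + 2M + 2)`: *"R enlarged, constants
only"*); Prop. 3.1 / (3.29) for the family (§3, same statement shape as gen 12 with `R₀ = (L/3)(2/δ + 2M + 2)`, `M` the large-block factor now a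
family parameter); and the constructor from the large-field data (§4): regions `Λ₅^{(j)} := towerRegion bad r j 5` (the typer's `towerOf`),
`L2_k := (Λ₂^{(k−1)})′`, `L1_k := (near Λ₀^{(k−1)} r(L^{k−1}ε))′ ⊆ Λ₋₁^{(k−1)′}`, `ζ^{(k)} := zeta244 k ρ_k`, with `nbhd` = `B2Eq28RegionsCollars.nbhd_radC`,
`L2_sub`, `lam_sub` and the four (2.44) clauses PROVED — only the cut-offs `θ_k`, the fields and the `θ`-slice inclusion remain data (§4
`RegionsData`); non-vacuity of `RegionsData` at `K = 1` for EVERY large-field datum (§5).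

WHAT IS PRINTED.  (3.3) p. 583: *"A^{(k),ε} = a_k(Lᵏε)^{−2}ζ^{(k)}G^ε_kQ*_kA_k"*; (2.44) p. 566: *"supp ζ^{(k)}(·, y) is contained in the set
{x ∈ T_η : |x − y| < r(Lᵏε) − 2M} and ζ^{(k)}(x, y) = 1 if |x − y| ≦ ½r(Lᵏε)"*; (2.7) p. 558: *"… less than r(ε) = R(1 + log ε⁻¹)^r. The numbers r, R
satisfy r > 1, R > R₀"*; (2.8) p. 558: *"Λ_{i+1}ᶜ is the sum of all large blocks of T₁ with distances from the set Λ_iᶜ less or equal r(ε)"*; p. 558: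
*"Let us denote by Λ^{(*,′)}_{−1} the set of the points (the bonds, the blocks) in T₁ distant from Λ₀ less than r(ε)"*; (2.55) p. 570 (the step-`k`
restrictions *"for x ∈ Λ₋₁^{(k−1)′}, b ⊂ Λ₋₁^{(k−1)′}"*); Lemma 2.3 p. 571: *"Under the restrictions (2.55) … x ∈ Bᵏ(y), y ∈ Λ₂^{(k−1)′} … Using
Proposition 2.2 and the restrictions (2.55) we can estimate the first two terms in (2.61) by O(1)p(Lᵏε)"*; Prop. 3.1 p. 589.

WHAT THIS MODULE PROVES (kernel-checked, 0 `sorry`, standard axioms; definitions with bodies: `radC`, `RMultiMR` + `.A/.field/.toRMultiP/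
.restrictedM`, `minP31FamR`, `min329FamR`, `towerRad`, `dataTower`, `L1Of`, `L2Of`, `RegionsData` + `.toRMultiMR`, `regionsDataW`; no `Prop` facts).
 §1 `radC` (= (c)), `radC_succ`, **`radC_ge_mul_u`** (`c₀(1 + log(Lᵏε)⁻¹) ≤ ρ_k` for `R ≥ (L/3)(c₀ + 2M + 2)`, `r ≥ 1`), `exp_neg_delta_radC_le`
    (`e^{−δρ_k/2} ≤ Lᵏε`), `six_le_radC`, `R_pos_of`, `rFn_pos_of`; **`lemma23_thresholds_rad`** (gen 11's `lemma23_thresholds` at ANY radius `ρ ≥ 0` with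
    `e^{−δρ/2} ≤ Lᵏε`: (2.59) `≤ thr259`, (2.60) `≤ thr260`, constants `c3Of`/`c5Of`).
 §2 `RMultiMR` (radius `ρ_k`; `hM : P.M = M`; `nbhd` for `1 ≤ k ≤ K`), `A`, `field`, `toRMultiP`, `restrictedM`, **`restricted_toRMultiP`**
    (`R ≥ (L/3)(2/δ + 2M + 2)`, `r ≥ 1`).
 §3 `minP31FamR`, `min329FamR`, **`prop31Printed_minimizersR`**, **`ineq329Printed_minimizersR`** (`∃ R₀ = (L/3)(2/δ + 2M + 2), c₃, c₅ ∀ Q (Q.d = d ∈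
    {2,3}, Q.L = L odd > 1, Q.a = a, Q.R ≥ R₀, Q.r ≥ 1, κ₀ < 2 − d/2), SmallEps ⇒ ∀ m², B2.Prop31Printed Q (minP31FamR Q Γ M m²)` / `Ineq329Printed`).
 §4 `towerRad`/`towerRad_nonneg`/`towerRad_eq`/`le_towerRad`, `dataTower` (= `towerOf`), `L1Of`/`L2Of`, `RegionsData` (the remaining DATA: torus,
    large-field sets `bad`, `θ_k` with their printed properties relative to the constructed tower, `A₀`, `A_k`, `Φ`, the `θ`-slice inclusion;
    and the printed largeness `R ≥ (L/3)(2M + 8)`, `r ≥ 1`), **`RegionsData.toRMultiMR`** (regions, cut-offs and `nbhd`/`L2_sub`/`lam_sub`/`ζ_*`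
    CONSTRUCTED and PROVED), `toRMultiMR_restrictedM_iff` (what `restricted` means for it: (2.55) on `(near Λ₀^{(k−1)} r)′`, variation over
    `(Λ₂^{(k−1)})′`, (2.17) on the slices, (2.55)₄).
 §5 `regionsDataW` + `regionsDataW_restrictedM`: for EVERY torus of the sub-family with `Lε ≤ ε₀` and EVERY large-field datum `bad`, a `K = 1`
    instance (θ₁ ≡ 1, `A_k ≡ v`, `Φ = 0`) whose image is restricted once `‖v‖ ≤ c_{A1}(Lε)^{−d/2}p(Lε)`.
HONEST SCOPE.  (i) = gen 11/12's (i), (iv)–(vi), (viii) verbatim (integrated reading of (2.55)₁; zero external field, torus sub-family, `d = 2, 3`;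
constants through r14's `(δ, C₁, C₂)`; (2.17)/(2.55)₄ stay restrictions; no head claims).  (ii) The radius `ρ_k` is the cell's READING (c) of
G-B2-12, not the printed `r(Lᵏε) − 2M`; with it the support of `ζ^{(k)}(x, ·)` over `Bᵏ(Λ₂^{(k−1)′})` provably lies in `(near Λ₀^{(k−1)} r)′ ⊆ Λ₋₁^{(k−1)′}`
(print's block set *"distant from Λ₀ less than r"* is larger, so (2.55) is assumed on LESS than print: faithful direction).  (iii) `R₀` now depends
on `(d, L, M, a, μ₀², ε₀)` (`M` the large-block factor of I p. 607, a fixed integer in print).  (iv) Still DATA in `RegionsData`: which points are bad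
at each step (the characteristic functions decide), the cut-offs `θ_k` with their printed properties (p. 567) and the inclusion of the `θ_{k+1}`-slice
in `Bᵏ⁺¹((Λ₂^{(k)})′)`, the fields.  (v) Non-vacuity at `K = 1` only here (multi-step: gen 12's `B2Prop31MinimizerWitness2` pattern applies
unchanged); the field of the §5 instance is not shown `≠ 0` in this file.  Nothing here is summit progress.
-/

noncomputable section

open Finset Real
open scoped BigOperators

namespace Literature.MathematicalPhysics.QuantumFieldTheory.Balaban1983to89.B2Prop31MinimizerRegions

open Literature.MathematicalPhysics.QuantumFieldTheory.Balaban1983to89.HiggsLattice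
open Literature.MathematicalPhysics.QuantumFieldTheory.Balaban1983to89.HiggsAveraging
open Literature.MathematicalPhysics.QuantumFieldTheory.Balaban1983to89.B2Eq337ScalarIntegration
open Literature.MathematicalPhysics.QuantumFieldTheory.Balaban1983to89.B2Eq328ConcretePieces
open Literature.MathematicalPhysics.QuantumFieldTheory.Balaban1983to89.B2Prop31ZeroFieldConcrete
open Literature.MathematicalPhysics.QuantumFieldTheory.Balaban1983to89.B2Eq324NestedRegions
open Literature.MathematicalPhysics.QuantumFieldTheory.Balaban1983to89.B2Eq32FieldRegularity
open Literature.MathematicalPhysics.QuantumFieldTheory.Balaban1983to89.B2Prop31Thresholds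
open Literature.MathematicalPhysics.QuantumFieldTheory.Balaban1983to89.B2Prop31PrintedRestrictions
open Literature.MathematicalPhysics.QuantumFieldTheory.Balaban1983to89.B3MultiscaleFields (toSite ofSite zeroCharge toSite_ofSite)
open Literature.MathematicalPhysics.QuantumFieldTheory.Balaban1983to89.B2Lemma23HiggsLattice (cutMin)
open Literature.MathematicalPhysics.QuantumFieldTheory.Balaban1983to89.B1Eq211ZeroFieldTorus (Shape)
open Literature.MathematicalPhysics.QuantumFieldTheory.Balaban1983to89.B2Prop31MinimizerFamily
  (MinConsts Lemma23Bounds exists_lemma23Bounds bound259_le_thr259 bound260_le_thr260)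
open Literature.MathematicalPhysics.QuantumFieldTheory.Balaban1983to89.B2Prop31MinimizerWitness (thetaW thetaW_one thetaW_of_ne nested_thetaW chargeW thrQ_nonneg)
open Literature.MathematicalPhysics.QuantumFieldTheory.Balaban1983to89.B2Eq244Cutoff
  (zeta244 abs_zeta244_le_one zeta244_supp zeta244_eq_one zeta244_lip le_rFn)
open Literature.MathematicalPhysics.QuantumFieldTheory.Balaban1983to89.B2Eq243RegionsTower (towerRegion towerOf towerOf_lam_of_lt)
open Literature.MathematicalPhysics.QuantumFieldTheory.Balaban1983to89.B2Eq28RegionsConcrete (near)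
open Literature.MathematicalPhysics.QuantumFieldTheory.Balaban1983to89.B2Eq28RegionsCollars (nbhd_radC prime_towerRegion_two_subset prime_lam_subset)
open B2Sect2BDensities (Nested)

/-! ## §1 The ruled radius (c), its largeness for `R` large, and Lemma 2.3 in the threshold shape at a general radius -/

/-- **The step-`k` cut-off radius (c) of GAPS.md G-B2-12** (owner adjudication r02 g11 2026-08-22T04:40Z on r14 g13's reader note):
`ρ_k = 3r(L^{k−1}ε)/L − 2M − 2` in lattice units of `T^{(k)}`, `r(s) = R(1 + log s⁻¹)^r` ((2.7)), `M` the large-block factor (I p. 607) — a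
READING replacing the printed (2.44) radius `r(Lᵏε) − 2M`, so that `supp ζ^{(k)}(x, ·) ⊂ Λ₋₁^{(k−1)′}` over `Bᵏ(Λ₂^{(k−1)′})`.
[cite: Balaban1982Higgs2, (2.44) p.566, (2.7)–(2.8) p.558] -/
def radC (R r : ℝ) (P : HiggsLattice.Params) (k : ℕ) : ℝ :=
  3 * B2.rFn R r (P.mesh (k - 1)) / (P.L : ℝ) - 2 * (P.M : ℝ) - 2

/-- `ρ_{l+1} = 3r(Lˡε)/L − 2M − 2` (definitional). [cite: Balaban1982Higgs2, (2.44) p.566] -/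
theorem radC_succ (R r : ℝ) (P : HiggsLattice.Params) (l : ℕ) :
    radC R r P (l + 1) = 3 * B2.rFn R r (P.mesh l) / (P.L : ℝ) - 2 * (P.M : ℝ) - 2 := rfl

/-- **`ρ_k` is large when `R` is** (*"R > R₀"* of (2.7)): for `1 ≤ k`, `0 < Lᵏε ≤ 1`, `c₀ ≥ 0`, `r ≥ 1` and `R ≥ (L/3)(c₀ + 2M + 2)`:
`c₀·(1 + log(Lᵏε)⁻¹) ≤ ρ_k` (since `r(L^{k−1}ε) ≥ R(1 + log(L^{k−1}ε)⁻¹) ≥ R(1 + log(Lᵏε)⁻¹)`). [cite: Balaban1982Higgs2, (2.7) p.558, (2.44) p.566] -/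
theorem radC_ge_mul_u {R r c₀ : ℝ} {P : HiggsLattice.Params} {k : ℕ} (hk1 : 1 ≤ k) (hs1 : P.mesh k ≤ 1) (hc₀ : 0 ≤ c₀)
    (hR : (P.L : ℝ) / 3 * (c₀ + 2 * (P.M : ℝ) + 2) ≤ R) (hr : 1 ≤ r) :
    c₀ * (1 + Real.log (P.mesh k)⁻¹) ≤ radC R r P k := by
  obtain ⟨l, rfl⟩ : ∃ l, k = l + 1 := ⟨k - 1, by omega⟩
  rw [radC_succ]
  set s : ℝ := P.mesh (l + 1) with hs_def
  set s' : ℝ := P.mesh l with hs'_def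
  have hs : 0 < s := P.mesh_pos (l + 1)
  have hs' : 0 < s' := P.mesh_pos l
  have hs's : s' ≤ s := mesh_le_mesh (Nat.le_succ l)
  have hs'1 : s' ≤ 1 := hs's.trans hs1
  have hL : (0 : ℝ) < (P.L : ℝ) := by exact_mod_cast P.hL
  have hM : (0 : ℝ) ≤ (P.M : ℝ) := Nat.cast_nonneg _
  have hR0 : 0 ≤ R := le_trans (by positivity) hR
  have hu : 1 ≤ 1 + Real.log s⁻¹ := one_le_u hs hs1
  have hu' : 1 + Real.log s⁻¹ ≤ 1 + Real.log s'⁻¹ := by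
    have : Real.log s⁻¹ ≤ Real.log s'⁻¹ :=
      Real.log_le_log (inv_pos.mpr hs) ((inv_le_inv₀ hs hs').mpr hs's)
    linarith
  have hu'1 : 1 ≤ 1 + Real.log s'⁻¹ := hu.trans hu'
  -- `r(s') = R·u'^r ≥ R·u' ≥ R·u`
  have hrFn : R * (1 + Real.log s⁻¹) ≤ B2.rFn R r s' := by
    unfold B2.rFn
    have h1 : 1 + Real.log s'⁻¹ ≤ (1 + Real.log s'⁻¹) ^ r := Real.self_le_rpow_of_one_le hu'1 hr
    calc R * (1 + Real.log s⁻¹) ≤ R * (1 + Real.log s'⁻¹) := mul_le_mul_of_nonneg_left hu' hR0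
      _ ≤ R * (1 + Real.log s'⁻¹) ^ r := mul_le_mul_of_nonneg_left h1 hR0
  -- `3R/L ≥ c₀ + 2M + 2`
  have hR' : (c₀ + 2 * (P.M : ℝ) + 2) * (1 + Real.log s⁻¹) ≤ 3 * (R * (1 + Real.log s⁻¹)) / (P.L : ℝ) := by
    rw [le_div_iff₀ hL]
    have h2 : (c₀ + 2 * (P.M : ℝ) + 2) * (P.L : ℝ) ≤ 3 * R := by
      have := mul_le_mul_of_nonneg_left hR (by norm_num : (0 : ℝ) ≤ 3)
      have h3 : 3 * ((P.L : ℝ) / 3 * (c₀ + 2 * (P.M : ℝ) + 2)) = (c₀ + 2 * (P.M : ℝ) + 2) * (P.L : ℝ) := by ring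
      linarith
    have h0 : 0 ≤ 1 + Real.log s⁻¹ := by linarith
    nlinarith
  have h4 : 3 * (R * (1 + Real.log s⁻¹)) / (P.L : ℝ) ≤ 3 * B2.rFn R r s' / (P.L : ℝ) :=
    div_le_div_of_nonneg_right (by linarith) hL.le
  have h5 : (2 * (P.M : ℝ) + 2) * 1 ≤ (2 * (P.M : ℝ) + 2) * (1 + Real.log s⁻¹) :=
    mul_le_mul_of_nonneg_left hu (by positivity)
  nlinarith

/-- **The tail is absorbed**: `e^{−δρ_k/2} ≤ Lᵏε` for `R ≥ (L/3)(2/δ + 2M + 2)`, `r ≥ 1`, `0 < Lᵏε ≤ 1`, `k ≥ 1` (the cell's *"price …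
c₀e^{−δ₀ρ_k/2} … absorbed in (2.59)–(2.60) with R enlarged"*; cf. gen 11's `exp_neg_delta_rho_le` for the radius `r(Lᵏε)`).
[cite: Balaban1982Higgs2, (2.7) p.558, (2.44) p.566, Lemma 2.3 p.571] -/
theorem exp_neg_delta_radC_le {R r δ : ℝ} {P : HiggsLattice.Params} {k : ℕ} (hk1 : 1 ≤ k) (hs1 : P.mesh k ≤ 1) (hδ : 0 < δ)
    (hR : (P.L : ℝ) / 3 * (2 / δ + 2 * (P.M : ℝ) + 2) ≤ R) (hr : 1 ≤ r) :
    Real.exp (-(δ * (radC R r P k / 2))) ≤ P.mesh k := by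
  have hs : 0 < P.mesh k := P.mesh_pos k
  have h := radC_ge_mul_u hk1 hs1 (by positivity : (0 : ℝ) ≤ 2 / δ) hR hr
  have hkey : 1 + Real.log (P.mesh k)⁻¹ ≤ δ * (radC R r P k / 2) := by
    have h' := mul_le_mul_of_nonneg_left h hδ.le
    have h'' : δ * (2 / δ * (1 + Real.log (P.mesh k)⁻¹)) = 2 * (1 + Real.log (P.mesh k)⁻¹) := by field_simp
    linarith
  have hlog : Real.log (P.mesh k)⁻¹ = -Real.log (P.mesh k) := Real.log_inv _
  calc Real.exp (-(δ * (radC R r P k / 2))) ≤ Real.exp (Real.log (P.mesh k)) := Real.exp_le_exp.2 (by linarith)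
    _ = P.mesh k := Real.exp_log hs

/-- `ρ_k ≥ 6` (so the plateau `½ρ_k` of `zeta244` fits: `½ρ_k + 3 ≤ ρ_k`) for `R ≥ (L/3)(2M + 8)`, `r ≥ 1`, `0 < Lᵏε ≤ 1`, `k ≥ 1`.
[cite: Balaban1982Higgs2, (2.44) p.566, (2.7) p.558] -/
theorem six_le_radC {R r : ℝ} {P : HiggsLattice.Params} {k : ℕ} (hk1 : 1 ≤ k) (hs1 : P.mesh k ≤ 1)
    (hR : (P.L : ℝ) / 3 * (2 * (P.M : ℝ) + 8) ≤ R) (hr : 1 ≤ r) : 6 ≤ radC R r P k := by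
  have hR' : (P.L : ℝ) / 3 * (6 + 2 * (P.M : ℝ) + 2) ≤ R := by
    have : (P.L : ℝ) / 3 * (6 + 2 * (P.M : ℝ) + 2) = (P.L : ℝ) / 3 * (2 * (P.M : ℝ) + 8) := by ring
    rw [this]; exact hR
  have h : 6 * (1 + Real.log (P.mesh k)⁻¹) ≤ radC R r P k := radC_ge_mul_u hk1 hs1 (by norm_num : (0 : ℝ) ≤ 6) hR' hr
  have hu : 1 ≤ 1 + Real.log (P.mesh k)⁻¹ := one_le_u (P.mesh_pos k) hs1
  nlinarith

/-- `R > 0` once `R ≥ (L/3)(2M + 8)` (`L ≥ 1`, `M ≥ 0`). [cite: Balaban1982Higgs2, (2.7) p.558] -/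
theorem R_pos_of {R : ℝ} {P : HiggsLattice.Params} (hR : (P.L : ℝ) / 3 * (2 * (P.M : ℝ) + 8) ≤ R) : 0 < R := by
  have hL : (1 : ℝ) ≤ (P.L : ℝ) := by exact_mod_cast P.hL
  have hM : (0 : ℝ) ≤ (P.M : ℝ) := Nat.cast_nonneg _
  exact lt_of_lt_of_le (by nlinarith) hR

/-- `r(s) > 0` for `0 < s ≤ 1`, `r ≥ 0`, once `R ≥ (L/3)(2M + 8)`. [cite: Balaban1982Higgs2, (2.7) p.558] -/
theorem rFn_pos_of {R r : ℝ} {P : HiggsLattice.Params} (hR : (P.L : ℝ) / 3 * (2 * (P.M : ℝ) + 8) ≤ R) (hr : 0 ≤ r) {s : ℝ}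
    (hs : 0 < s) (hs1 : s ≤ 1) : 0 < B2.rFn R r s :=
  lt_of_lt_of_le (R_pos_of hR) (le_rFn (R_pos_of hR).le hr hs hs1)

/-- `|v_μ − w_μ| ≤ ‖v − w‖` in `ℝᵈ`. [folklore] [cite: Balaban1982Higgs1, (1.22) p.607] -/
private theorem abs_apply_sub_le {n : ℕ} (v w : EuclideanSpace ℝ (Fin n)) (μ : Fin n) : |v μ - w μ| ≤ ‖v - w‖ := by
  have h := PiLp.norm_apply_le (v - w) μ
  simpa [Real.norm_eq_abs] using h

/-- **LEMMA 2.3 IN THE GEN-10 THRESHOLD SHAPE, ONE LEVEL, AT A GENERAL CUT-OFF RADIUS `ρ`** (`1 ≤ k ≤ K`, `s = Lᵏε ≤ min(ε₀, 1)`): as gen 11's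
`B2Prop31MinimizerFamily.lemma23_thresholds`, with the (2.44) clauses at radius `ρ ≥ 0`, plateau `½ρ`, `nbhd` at `ρ + 1`, and the tail hypothesis
`e^{−δρ/2} ≤ s` in place of `R ≥ 2/δ`: (2.59) `|A^{(k),ε}(⟨x,μ⟩) − A_k(⟨x_k,μ⟩)| ≤ thr259(s)`, (2.60) `|A^{(k),ε}(⟨x+εe_ν,μ⟩) − A^{(k),ε}(⟨x,μ⟩)| ≤ thr260(ε,s)`
for the derived `c₃ = c3Of`, `c₅ = c5Of`. [cite: Balaban1982Higgs2, Lemma 2.3 (2.59)–(2.60) p.571, (3.3) p.583, (2.44) p.566] -/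
theorem lemma23_thresholds_rad {d L : ℕ} {a ε₀ δ C₁ C₂ : ℝ} {Γ : MinConsts} (hΓ : Γ.Valid) (ha : 0 < a)
    (pkg : Lemma23Bounds d L a Γ.μ0sq ε₀ δ C₁ C₂) (hC₂ : 0 ≤ C₂)
    {P : HiggsLattice.Params} (S : Shape P) (hPd : P.d = d) (hPL : P.L = L)
    {k : ℕ} (hk1 : 1 ≤ k) (hk : k ≤ P.K) (hs1 : P.mesh k ≤ 1) (hsε : P.mesh k ≤ ε₀)
    {ρ : ℝ} (hρ0 : 0 ≤ ρ) (hE : Real.exp (-(δ * (ρ / 2))) ≤ P.mesh k)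
    (ζ : HiggsLattice.Site P 0 → HiggsLattice.Site P k → ℝ)
    (habs : ∀ x y', |ζ x y'| ≤ 1)
    (hsupp : ∀ x y', ζ x y' ≠ 0 → (HiggsLattice.Site.tdist (blockIter k x) y' : ℝ) ≤ ρ)
    (hone : ∀ x y', (HiggsLattice.Site.tdist (blockIter k x) y' : ℝ) ≤ ρ / 2 → ζ x y' = 1)
    (hlip : ∀ (x : HiggsLattice.Site P 0) (ν : Fin P.d) (y' : HiggsLattice.Site P k),
      |ζ (x.shift ν) y' - ζ x y'| ≤ ((P.L : ℝ) ^ k)⁻¹)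
    (Λ₁ Λ₂ : Finset (HiggsLattice.Site P k)) (hsub : Λ₂ ⊆ Λ₁)
    (nbhd : ∀ x y', blockIter k x ∈ Λ₂ → (HiggsLattice.Site.tdist (blockIter k x) y' : ℝ) ≤ ρ + 1 → y' ∈ Λ₁)
    (Ak : HiggsLattice.VecField P k)
    (hA : ∀ y' ∈ Λ₁, ‖toSite Ak y'‖ ≤ Γ.thrA P.d (P.mesh k))
    (hvar : ∀ y ∈ Λ₂, ∀ y' ∈ Λ₁,
      ‖toSite Ak y' - toSite Ak y‖ ≤ Γ.thrQ P.d (P.mesh k) * (Γ.r₁ + Γ.r₂ * (HiggsLattice.Site.tdist y y' : ℝ)))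
    (x : HiggsLattice.Site P 0) (hx : blockIter k x ∈ Λ₂) (μ ν : Fin P.d) :
    |ofSite (cutMin (zeroCharge P.d) Γ.μ0sq a k ζ (toSite Ak)) ⟨x, μ⟩ - Ak ⟨blockIter k x, μ⟩|
        ≤ thr259 (Γ.toConsts (Γ.c3Of a L C₁ C₂) (Γ.c5Of C₁ C₂)) P.d (P.mesh k)
    ∧ |ofSite (cutMin (zeroCharge P.d) Γ.μ0sq a k ζ (toSite Ak)) ⟨x.shift ν, μ⟩
        - ofSite (cutMin (zeroCharge P.d) Γ.μ0sq a k ζ (toSite Ak)) ⟨x, μ⟩|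
        ≤ thr260 (Γ.toConsts (Γ.c3Of a L C₁ C₂) (Γ.c5Of C₁ C₂)) P.d P.ε (P.mesh k) := by
  subst hPd hPL
  have hs : 0 < P.mesh k := P.mesh_pos k
  have hLr : (1 : ℝ) < P.L := by exact_mod_cast S.hL.2
  have hq : 0 ≤ Γ.thrQ P.d (P.mesh k) := thrQ_nonneg hΓ hs hs1 P.d
  have hρ₁ : 0 ≤ ρ / 2 := by linarith
  obtain ⟨h59, h60⟩ := pkg P S rfl rfl (zeroCharge P.d) hk1 hk hsε ζ ρ (ρ / 2) hρ₁ habs hsupp hone hlip Λ₁ Λ₂ hsub nbhd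
    (toSite Ak) (Γ.thrA P.d (P.mesh k)) (Γ.thrQ P.d (P.mesh k)) Γ.r₁ Γ.r₂ hq hΓ.r₁_nonneg hΓ.r₂_nonneg hA hvar x hx
  have hak : a * (1 - ((P.L : ℝ) ^ 2)⁻¹) < B1.aSeq a P.L k := B1.ainf_lt_aSeq ha hLr k hk1
  set Mn : HiggsLattice.ScalarField P 0 P.d := cutMin (zeroCharge P.d) Γ.μ0sq a k ζ (toSite Ak)
  refine ⟨?_, ?_⟩
  · have hcomp : |ofSite Mn ⟨x, μ⟩ - Ak ⟨blockIter k x, μ⟩| ≤ ‖Mn x - toSite Ak (blockIter k x)‖ :=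
      abs_apply_sub_le (Mn x) (toSite Ak (blockIter k x)) μ
    refine hcomp.trans (h59.trans ?_)
    exact bound259_le_thr259 hΓ ha S.hL.2 hC₂ P.d hs hs1 hE hak _
  · have hcomp : |ofSite Mn ⟨x.shift ν, μ⟩ - ofSite Mn ⟨x, μ⟩| ≤ ‖Mn (x.shift ν) - Mn x‖ :=
      abs_apply_sub_le (Mn (x.shift ν)) (Mn x) μ
    refine hcomp.trans ((h60 ν).trans ?_)
    exact bound260_le_thr260 hΓ hC₂ P.d P.hε.le hs hs1 rfl hE _

/-! ## §2 The carrier with the (2.44) radius (c) -/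

/-- **One instance of Proposition 3.1 with the (3.3) minimizers, the (2.55) restrictions and the (2.44) cut-offs at the radius (c)**: the data
of `RMultiMK` (p315587) — lattice member of the torus sub-family with large-block factor `M`, steps `K`, stopping rule, tower of regions
`Λ₅⁽ᵏ⁾`, charge data, cut-offs `θ_k` with their printed properties, `A₀`, block vector fields `A_k`, configuration `Φ`, cut-offs `ζ^{(k)}` and
regions `Λ₂ ⊆ Λ₁` per level with the `nbhd` / `Λ₅ ⊂ Λ₂` / slice hypotheses — with ONE change: the support / plateau / `nbhd` radii of level `k`
are `ρ_k = radC`, `½ρ_k`, `ρ_k + 1` (and `nbhd` is asked for `1 ≤ k ≤ K` only). [cite: Balaban1982Higgs2, Prop. 3.1 p.589, (3.2)–(3.3) p.583, (2.44) p.566, (2.55) p.570, (2.7)–(2.8) p.558] -/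
structure RMultiMR (Q : B2.Params) (Γ : MinConsts) (M : ℕ) (m2 : ℝ) where
  /-- the lattice family member (tori `T^{(k)}_{Lᵏε}`) -/
  P : HiggsLattice.Params
  hL : P.L = Q.L
  hd : P.d = Q.d
  /-- the large-block factor is the family's `M` (I p. 607) -/
  hM : P.M = M
  /-- the torus sub-family `M·L′_μ = Lᵐ`, `L` odd (r14's/p14's decay bounds) -/
  S : Shape P
  /-- number of real scalar-field components -/
  N : ℕ
  /-- number of renormalization steps -/
  K : ℕ
  hK : K ≤ P.K
  /-- the stopping rule `Lᴷε ≤ ε₀` (p. 582) -/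
  hε₀ : P.mesh K ≤ Γ.ε₀
  /-- the tower of large-field regions `Λ₅⁽ᵏ⁾` -/
  T : Tower P K
  C : ChargeData N
  /-- the model's coupling constant -/
  hCe : C.e = Γ.e
  /-- the cut-offs `θ_k` on the fine torus, with their printed properties (as in `RMultiP`) -/
  θ : ℕ → HiggsLattice.Site P 0 → ℝ
  θ_nested : Nested θ
  θ_range : ∀ m (z : HiggsLattice.Site P 0), 0 ≤ θ m z ∧ θ m z ≤ 1
  θ_one : ∀ k, 1 ≤ k → k ≤ K → ∀ z : HiggsLattice.Site P 0, T.lamAt (k - 1) z → θ k z = 1 ∧ ∀ ν, θ k (z.shift ν) = 1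
  θ_zero : ∀ k, k + 2 ≤ K → ∀ z : HiggsLattice.Site P 0,
    (θ (k + 2) z ≠ 0 ∨ ∃ ν, θ (k + 2) (z.shift ν) ≠ 0) → T.lamAt k z
  θ_above : ∀ m, K < m → ∀ z : HiggsLattice.Site P 0, θ m z = 0
  θ_lip : ∀ k (z : HiggsLattice.Site P 0) (ν : Fin P.d), |θ (k + 1) (z.shift ν) - θ (k + 1) z| ≤ Γ.cθ * ((P.L : ℝ) ^ k)⁻¹
  /-- `A₀` of (3.2) -/
  A₀ : HiggsLattice.VecField P 0
  /-- the block vector fields `A_k` on `T⁽ᵏ⁾` -/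
  Ac : (k : ℕ) → HiggsLattice.VecField P k
  /-- the configuration `Φ` of (3.24) -/
  Φ : Cfg T.regions N
  /-- the cut-offs `ζ^{(k)}(x, y′)` of (2.44), `y′` a block label of `T⁽ᵏ⁾` (only `1 ≤ k ≤ K` matter) -/
  ζ : (k : ℕ) → HiggsLattice.Site P 0 → HiggsLattice.Site P k → ℝ
  ζ_abs : ∀ k, 1 ≤ k → k ≤ K → ∀ x y', |ζ k x y'| ≤ 1
  /-- support radius `ρ_k` = (c) -/
  ζ_supp : ∀ k, 1 ≤ k → k ≤ K → ∀ x y', ζ k x y' ≠ 0 →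
    (HiggsLattice.Site.tdist (blockIter k x) y' : ℝ) ≤ radC Q.R Q.r P k
  /-- plateau radius `½ρ_k` -/
  ζ_one : ∀ k, 1 ≤ k → k ≤ K → ∀ x y',
    (HiggsLattice.Site.tdist (blockIter k x) y' : ℝ) ≤ radC Q.R Q.r P k / 2 → ζ k x y' = 1
  /-- *"|(∂^η_xζ^{(k)})(b, y)| ≦ 1"*: Lipschitz `L^{−k}` per fine step -/
  ζ_lip : ∀ k, 1 ≤ k → k ≤ K → ∀ (x : HiggsLattice.Site P 0) (ν : Fin P.d) (y' : HiggsLattice.Site P k),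
    |ζ k (x.shift ν) y' - ζ k x y'| ≤ ((P.L : ℝ) ^ k)⁻¹
  /-- the `Λ₁`-region of level `k` (print: `Λ₋₁⁽ᵏ⁻¹⁾′`), where (2.55) holds -/
  L1 : (k : ℕ) → Finset (HiggsLattice.Site P k)
  /-- the `Λ₂`-region of level `k` (print: `Λ₂⁽ᵏ⁻¹⁾′`), over which (2.59)/(2.60) are used -/
  L2 : (k : ℕ) → Finset (HiggsLattice.Site P k)
  L2_sub : ∀ k, L2 k ⊆ L1 k
  /-- the range of `ζ^{(k)}` (+1) around `Bᵏ(Λ₂-region)` lies in the `Λ₁`-region, steps `1 ≤ k ≤ K` -/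
  nbhd : ∀ k, 1 ≤ k → k ≤ K → ∀ x y', blockIter k x ∈ L2 k →
    (HiggsLattice.Site.tdist (blockIter k x) y' : ℝ) ≤ radC Q.R Q.r P k + 1 → y' ∈ L1 k
  /-- `Λ₅⁽ʲ⁾′ ⊆ Λ₂-region of level j + 1` (print: `Λ₅ ⊂ Λ₂`) -/
  lam_sub : ∀ j, j < K → B2Eq324NestedRegions.prime (T.lam j) ⊆ L2 (j + 1)
  /-- the `θ_{j+2}`-slice lies within `Bʲ⁺²(Λ₂-region of level j + 2)` -/
  slice_sub : ∀ j (z : HiggsLattice.Site P 0) (ν : Fin P.d),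
    (θ (j + 2) z ≠ 0 ∨ θ (j + 2) (z.shift ν) ≠ 0) → blockIter (j + 2) z ∈ L2 (j + 2)

namespace RMultiMR

variable {Q : B2.Params} {Γ : MinConsts} {M : ℕ} {m2 : ℝ}

/-- **THE MINIMIZERS (3.3) OF THE INSTANCE**: `A^{(k),ε} = a_k(Lᵏε)^{−2}ζ^{(k)}G^ε_kQ*_kA_k` (r14's `cutMin`, vector-field case `N = d`).
[cite: Balaban1982Higgs2, (3.3) p.583] -/
def A (i : RMultiMR Q Γ M m2) (k : ℕ) : HiggsLattice.VecField i.P 0 :=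
  ofSite (cutMin (zeroCharge i.P.d) Γ.μ0sq Q.a k (i.ζ k) (toSite (i.Ac k)))

/-- Pointwise: `A^{(k),ε}(⟨x, μ⟩) = (cutMin … (toSite A_k))(x)_μ` (definitional). [cite: Balaban1982Higgs2, (3.3) p.583] -/
theorem A_apply (i : RMultiMR Q Γ M m2) (k : ℕ) (x : HiggsLattice.Site i.P 0) (μ : Fin i.P.d) :
    i.A k ⟨x, μ⟩ = cutMin (zeroCharge i.P.d) Γ.μ0sq Q.a k (i.ζ k) (toSite (i.Ac k)) x μ := rfl

/-- **The field `Ã^ε` of the instance**: (3.2) built from the cut-offs, `A₀` and the (3.3) minimizers. [cite: Balaban1982Higgs2, (3.2) p.583] -/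
def field (i : RMultiMR Q Γ M m2) : HiggsLattice.VecField i.P 0 := field32 i.θ i.A₀ i.A i.K

/-- **The map to the gen-10 carrier**: the same data, the minimizers SUPPLIED by (3.3). [cite: Balaban1982Higgs2, Prop. 3.1 p.589] -/
def toRMultiP (i : RMultiMR Q Γ M m2) (c₃ c₅ : ℝ) : RMultiP Q (Γ.toConsts c₃ c₅) m2 where
  P := i.P
  hL := i.hL
  hd := i.hd
  N := i.N
  K := i.K
  hK := i.hK
  hε₀ := i.hε₀
  T := i.T
  C := i.C
  hCe := i.hCe
  θ := i.θ
  θ_nested := i.θ_nested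
  θ_range := i.θ_range
  θ_one := i.θ_one
  θ_zero := i.θ_zero
  θ_above := i.θ_above
  θ_lip := i.θ_lip
  A₀ := i.A₀
  A := i.A
  Ac := i.Ac
  Φ := i.Φ

/-- The image has the same field `Ã^ε` (definitional). [cite: Balaban1982Higgs2, (3.2) p.583] -/
theorem toRMultiP_field (i : RMultiMR Q Γ M m2) (c₃ c₅ : ℝ) : (i.toRMultiP c₃ c₅).field = i.field := rfl

/-- **THE PRINTED RESTRICTIONS ON THE BLOCK FIELDS** (verbatim the body of `RMultiMK.restrictedM`): (2.55)₂ on the `Λ₁`-region, (2.55)₁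
(integrated) for `y` in the `Λ₂`-region and `y′` in the `Λ₁`-region, (2.17) on the `θ_{k+1}`-slices, (2.55)₄ on `Λ_k`; NO minimizer, NO
(2.59)/(2.60) assumed. [cite: Balaban1982Higgs2, Prop. 3.1 p.589, (3.21) p.588, (2.55) p.570, (2.17) p.560, (3.15) p.586] -/
def restrictedM (i : RMultiMR Q Γ M m2) : Prop :=
  (∀ k, 1 ≤ k → k ≤ i.K → ∀ y' ∈ i.L1 k, ‖toSite (i.Ac k) y'‖ ≤ Γ.thrA i.P.d (i.P.mesh k))
  ∧ (∀ k, 1 ≤ k → k ≤ i.K → ∀ y ∈ i.L2 k, ∀ y' ∈ i.L1 k,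
      ‖toSite (i.Ac k) y' - toSite (i.Ac k) y‖
        ≤ Γ.thrQ i.P.d (i.P.mesh k) * (Γ.r₁ + Γ.r₂ * (HiggsLattice.Site.tdist y y' : ℝ)))
  ∧ (∀ (j : Fin i.K), ∀ z ∈ pieceF i.T.regions j, ∀ μ ν : Fin i.P.d,
      (i.θ (j.val + 2) z ≠ 0 ∨ i.θ (j.val + 2) (z.shift ν) ≠ 0) →
      |i.Ac (j.val + 2) ⟨blockIter (j.val + 2) z, μ⟩ - i.Ac (j.val + 1) ⟨blockIter (j.val + 1) z, μ⟩|
        ≤ Γ.thr217M i.P.d (i.P.mesh (j.val + 1)))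
  ∧ (∀ (j : Fin i.K) (y : LSite i.T.regions j), ‖resL i.T.regions j i.Φ y‖ ≤ Γ.thrφM i.P.d (i.P.mesh (j.val + 1)))

/-- `s_k ≤ ε₀ ≤ 1` for `k ≤ K`. [cite: Balaban1982Higgs2, p.582] -/
theorem mesh_le_eps0 (hΓ : Γ.Valid) (i : RMultiMR Q Γ M m2) {k : ℕ} (hk : k ≤ i.K) : i.P.mesh k ≤ Γ.ε₀ ∧ i.P.mesh k ≤ 1 :=
  ⟨(mesh_le_mesh hk).trans i.hε₀, ((mesh_le_mesh hk).trans i.hε₀).trans hΓ.ε₀_le_one⟩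

/-- A fine point of `Bᵏ(Λ_k)` (`k = j + 1`) has its `k`-block label in `Λ₅⁽ʲ⁾′ ⊆ Λ₂-region of level k`. [cite: Balaban1982Higgs2, (3.22)–(3.24) p.588] -/
theorem blockIter_mem_L2_of_mem_pieceF (i : RMultiMR Q Γ M m2) (j : Fin i.K) {z : HiggsLattice.Site i.P 0}
    (hz : z ∈ pieceF i.T.regions j) : blockIter (j.val + 1) z ∈ i.L2 (j.val + 1) := by
  have h2 : blockIter (j.val + 1) z ∈ B2Eq324NestedRegions.prime (i.T.lam j.val) \ i.T.lam (j.val + 1) :=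
    (mem_pieceF_iff i.T.regions j z).mp hz
  exact i.lam_sub j.val j.isLt (Finset.mem_sdiff.mp h2).1

/-- **THE PRINTED RESTRICTIONS IMPLY THE GEN-10 RESTRICTIONS** for the image instance, given Lemma-2.3 constants `(δ, C₁, C₂)`, `r ≥ 1` and the
ENLARGED largeness `R ≥ (L/3)(2/δ + 2M + 2)` of (2.7) (so that `e^{−δρ_k/2} ≤ Lᵏε`, §1): all six conjuncts of `RMultiP.restricted` with
`c₃ = c3Of`, `c₅ = c5Of` — the proof of `RMultiMK.restricted_toRMultiP` with `lemma23_thresholds_rad` at the radius `ρ_k`.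
[cite: Balaban1982Higgs2, Prop. 3.1 p.589, Lemma 2.3 p.571, (2.97)–(2.98) p.577, (2.7) p.558] -/
theorem restricted_toRMultiP (hΓ : Γ.Valid) (hQa : 0 < Q.a) {δ C₁ C₂ : ℝ}
    (pkg : Lemma23Bounds Q.d Q.L Q.a Γ.μ0sq Γ.ε₀ δ C₁ C₂) (hδ : 0 < δ) (hC₂ : 0 ≤ C₂)
    (hR : (Q.L : ℝ) / 3 * (2 / δ + 2 * (M : ℝ) + 2) ≤ Q.R) (hr : 1 ≤ Q.r) (i : RMultiMR Q Γ M m2) (hrM : i.restrictedM) :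
    (i.toRMultiP (Γ.c3Of Q.a Q.L C₁ C₂) (Γ.c5Of C₁ C₂)).restricted := by
  obtain ⟨hsup, hvar, h217, hΦ⟩ := hrM
  have hR' : (i.P.L : ℝ) / 3 * (2 / δ + 2 * (i.P.M : ℝ) + 2) ≤ Q.R := by rw [i.hL, i.hM]; exact hR
  have key : ∀ {k : ℕ}, 1 ≤ k → k ≤ i.K → ∀ (x : HiggsLattice.Site i.P 0), blockIter k x ∈ i.L2 k → ∀ μ ν : Fin i.P.d,
      |i.A k ⟨x, μ⟩ - i.Ac k ⟨blockIter k x, μ⟩|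
          ≤ thr259 (Γ.toConsts (Γ.c3Of Q.a Q.L C₁ C₂) (Γ.c5Of C₁ C₂)) i.P.d (i.P.mesh k)
      ∧ |i.A k ⟨x.shift ν, μ⟩ - i.A k ⟨x, μ⟩|
          ≤ thr260 (Γ.toConsts (Γ.c3Of Q.a Q.L C₁ C₂) (Γ.c5Of C₁ C₂)) i.P.d i.P.ε (i.P.mesh k) := by
    intro k hk1 hk x hx μ ν
    have hm := i.mesh_le_eps0 hΓ hk
    have hE : Real.exp (-(δ * (radC Q.R Q.r i.P k / 2))) ≤ i.P.mesh k := exp_neg_delta_radC_le hk1 hm.2 hδ hR' hr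
    have hρ0 : 0 ≤ radC Q.R Q.r i.P k := by
      have h := radC_ge_mul_u hk1 hm.2 (by positivity : (0 : ℝ) ≤ 2 / δ) hR' hr
      have hu : 1 ≤ 1 + Real.log (i.P.mesh k)⁻¹ := one_le_u (i.P.mesh_pos k) hm.2
      have : 0 ≤ 2 / δ * (1 + Real.log (i.P.mesh k)⁻¹) := by positivity
      linarith
    exact lemma23_thresholds_rad hΓ hQa pkg hC₂ i.S i.hd i.hL hk1 (hk.trans i.hK) hm.2 hm.1 hρ0 hE (i.ζ k) (i.ζ_abs k hk1 hk)
      (i.ζ_supp k hk1 hk) (i.ζ_one k hk1 hk) (i.ζ_lip k hk1 hk) (i.L1 k) (i.L2 k) (i.L2_sub k) (i.nbhd k hk1 hk) (i.Ac k)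
      (hsup k hk1 hk) (hvar k hk1 hk) x hx μ ν
  have hsl_le : ∀ (j : ℕ) (z : HiggsLattice.Site i.P 0) (ν : Fin i.P.d),
      (i.θ (j + 2) z ≠ 0 ∨ i.θ (j + 2) (z.shift ν) ≠ 0) → j + 2 ≤ i.K := by
    intro j z ν hsl
    by_contra hK
    have h0 := i.θ_above (j + 2) (by omega)
    rcases hsl with h | h
    · exact h (h0 z)
    · exact h (h0 (z.shift ν))
  refine ⟨?_, ?_, ?_, ?_, ?_, ?_⟩
  · intro j z hz μ ν
    have hj : j.val < i.K := j.isLt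
    exact (key (k := j.val + 1) (by omega) (by omega) z (i.blockIter_mem_L2_of_mem_pieceF j hz) μ ν).2
  · intro j z hz μ
    have hj : j.val < i.K := j.isLt
    exact (key (k := j.val + 1) (by omega) (by omega) z (i.blockIter_mem_L2_of_mem_pieceF j hz) μ μ).1
  · intro j z hz μ ν hsl
    have hsl' : i.θ (j.val + 2) z ≠ 0 ∨ i.θ (j.val + 2) (z.shift ν) ≠ 0 := hsl
    exact (key (k := j.val + 2) (by omega) (hsl_le j.val z ν hsl') z (i.slice_sub j.val z ν hsl') μ ν).2
  · intro j z hz μ ν hsl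
    have hsl' : i.θ (j.val + 2) z ≠ 0 ∨ i.θ (j.val + 2) (z.shift ν) ≠ 0 := hsl
    exact (key (k := j.val + 2) (by omega) (hsl_le j.val z ν hsl') z (i.slice_sub j.val z ν hsl') μ ν).1
  · intro j z hz μ ν hsl
    have hsl' : i.θ (j.val + 2) z ≠ 0 ∨ i.θ (j.val + 2) (z.shift ν) ≠ 0 := hsl
    have hz' : z ∈ pieceF i.T.regions j := hz
    rw [MinConsts.thr217_toConsts]
    exact h217 j z hz' μ ν hsl'
  · intro j y
    rw [MinConsts.thrφ_toConsts]
    exact hΦ j y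

end RMultiMR

/-! ## §3 The families and Proposition 3.1 / (3.29) for them -/

/-- **THE FAMILY OF `B2.P31Setting` WITH THE (3.3) MINIMIZERS, THE (2.55) RESTRICTIONS AND THE RADIUS (c)**: `restricted := restrictedM`; all other
fields as in gen 10's `printedP31Fam` for the image instance. [cite: Balaban1982Higgs2, Prop. 3.1 (3.26)–(3.28) p.589] -/
def minP31FamR (Q : B2.Params) (Γ : MinConsts) (M : ℕ) (m2 : ℝ) (i : RMultiMR Q Γ M m2) : B2.P31Setting :=
  { printedP31Fam Q (Γ.toConsts 0 0) m2 (i.toRMultiP 0 0) with restricted := i.restrictedM }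

/-- The numeric fields of `minP31FamR` are those of `printedP31Fam` at the image instance, for ANY `c₃`, `c₅` (definitional).
[cite: Balaban1982Higgs2, Prop. 3.1 p.589] -/
theorem minP31FamR_eq (Q : B2.Params) (Γ : MinConsts) (M : ℕ) (m2 : ℝ) (i : RMultiMR Q Γ M m2) (c₃ c₅ : ℝ) :
    minP31FamR Q Γ M m2 i = { printedP31Fam Q (Γ.toConsts c₃ c₅) m2 (i.toRMultiP c₃ c₅) with restricted := i.restrictedM } := rfl

/-- **THE PER-SCALE (3.29) FAMILY** (`restricted := restrictedM`). [cite: Balaban1982Higgs2, (3.29) p.590] -/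
def min329FamR (Q : B2.Params) (Γ : MinConsts) (M : ℕ) (m2 : ℝ) (ij : Σ i : RMultiMR Q Γ M m2, Fin i.K) : B2.I329Setting :=
  { printed329Fam Q (Γ.toConsts 0 0) m2 ⟨ij.1.toRMultiP 0 0, ij.2⟩ with restricted := ij.1.restrictedM }

/-- **PROPOSITION 3.1 (3.26) FOR THE FAMILY WITH THE PRINTED MINIMIZERS, THE PRINTED RESTRICTIONS AND THE CUT-OFF RADIUS (c).**  For
`d ∈ {2, 3}`, odd `L > 1`, the large-block factor `M`, `a > 0`, `μ₀² > 0`, `0 < ε₀ ≤ 1` there are `R₀ > 0` (*"R > R₀"* of (2.7); here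
`R₀ = (L/3)(2/δ + 2M + 2)`) and O(1)'s `c₃, c₅ ≥ 0` such that for every `Q` with `Q.d = d`, `Q.L = L`, `Q.a = a`, `Q.R ≥ R₀`, `Q.r ≥ 1`,
`Q.κ₀ < 2 − d/2`, every valid `Γ` with `Γ.μ0sq = μ₀²`, `Γ.ε₀ = ε₀` and small coupling (`SmallEps d L (Γ.toConsts c₃ c₅)`), and every `m² > 0`, the
cell's typed `B2.Prop31Printed Q` HOLDS on `minP31FamR Q Γ M m²` (both conjuncts). [cite: Balaban1982Higgs2, Prop. 3.1 (3.26) p.589, Lemma 2.3 p.571, (3.3) p.583, (2.44) p.566, (2.7) p.558] -/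
theorem prop31Printed_minimizersR (d L M : ℕ) (hd2 : 2 ≤ d) (hd3 : d ≤ 3) (hL : Odd L ∧ 1 < L) {a : ℝ} (ha : 0 < a)
    {μ0sq : ℝ} (hμ : 0 < μ0sq) (ε₀ : ℝ) (Γ : MinConsts) (hΓ : Γ.Valid) (hΓμ : Γ.μ0sq = μ0sq) (hΓε : Γ.ε₀ = ε₀) :
    ∃ R₀ c₃ c₅ : ℝ, 0 < R₀ ∧ 0 ≤ c₃ ∧ 0 ≤ c₅ ∧
      ∀ (Q : B2.Params), Q.d = d → Q.L = L → Q.a = a → R₀ ≤ Q.R → 1 ≤ Q.r → Q.κ₀ < 2 - (d : ℝ) / 2 →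
        SmallEps d L (Γ.toConsts c₃ c₅) → ∀ {m2 : ℝ}, 0 < m2 → B2.Prop31Printed Q (minP31FamR Q Γ M m2) := by
  obtain ⟨δ, C₁, C₂, hδ, hC₁, hC₂, pkg⟩ := exists_lemma23Bounds d L (by omega) hL ha hμ ε₀
  have hLpos : (0 : ℝ) < (L : ℝ) := by exact_mod_cast (lt_trans Nat.zero_lt_one hL.2)
  refine ⟨(L : ℝ) / 3 * (2 / δ + 2 * (M : ℝ) + 2), Γ.c3Of a L C₁ C₂, Γ.c5Of C₁ C₂, by positivity,
    MinConsts.c3Of_nonneg hΓ ha hL.2 hC₁.le hC₂.le, MinConsts.c5Of_nonneg hΓ hC₁.le hC₂.le, ?_⟩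
  intro Q hQd hQL hQa hR hRr hκ hsm m2 hm
  subst hQd hQL hQa hΓμ hΓε
  have hΓ'v : (Γ.toConsts (Γ.c3Of Q.a Q.L C₁ C₂) (Γ.c5Of C₁ C₂)).Valid :=
    MinConsts.toConsts_valid hΓ (MinConsts.c3Of_nonneg hΓ ha hL.2 hC₁.le hC₂.le) (MinConsts.c5Of_nonneg hΓ hC₁.le hC₂.le)
  obtain ⟨γ₀, Cc, hγ, hCc, h1, h2⟩ := prop31Printed_thresholds Q hL.2 ha hd2 hd3 hκ _ hΓ'v hsm hm
  refine ⟨γ₀, Cc, hγ, hCc, fun i hri => ?_, fun i hz => ?_⟩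
  · exact h1 (i.toRMultiP (Γ.c3Of Q.a Q.L C₁ C₂) (Γ.c5Of C₁ C₂))
      (RMultiMR.restricted_toRMultiP hΓ ha pkg hδ hC₂.le hR hRr i hri)
  · exact h2 (i.toRMultiP (Γ.c3Of Q.a Q.L C₁ C₂) (Γ.c5Of C₁ C₂)) hz

/-- **THE CELL'S TYPED (3.29) FOR THE PER-SCALE FAMILY WITH THE RADIUS (c)** (same constants; `m² ≥ 0`). [cite: Balaban1982Higgs2, (3.29) p.590] -/
theorem ineq329Printed_minimizersR (d L M : ℕ) (hd2 : 2 ≤ d) (hd3 : d ≤ 3) (hL : Odd L ∧ 1 < L) {a : ℝ} (ha : 0 < a)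
    {μ0sq : ℝ} (hμ : 0 < μ0sq) (ε₀ : ℝ) (Γ : MinConsts) (hΓ : Γ.Valid) (hΓμ : Γ.μ0sq = μ0sq) (hΓε : Γ.ε₀ = ε₀) :
    ∃ R₀ c₃ c₅ : ℝ, 0 < R₀ ∧ 0 ≤ c₃ ∧ 0 ≤ c₅ ∧
      ∀ (Q : B2.Params), Q.d = d → Q.L = L → Q.a = a → R₀ ≤ Q.R → 1 ≤ Q.r → Q.κ₀ < 2 - (d : ℝ) / 2 →
        SmallEps d L (Γ.toConsts c₃ c₅) → ∀ {m2 : ℝ}, 0 ≤ m2 → B2.Ineq329Printed Q.κ₀ (min329FamR Q Γ M m2) := by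
  obtain ⟨δ, C₁, C₂, hδ, hC₁, hC₂, pkg⟩ := exists_lemma23Bounds d L (by omega) hL ha hμ ε₀
  have hLpos : (0 : ℝ) < (L : ℝ) := by exact_mod_cast (lt_trans Nat.zero_lt_one hL.2)
  refine ⟨(L : ℝ) / 3 * (2 / δ + 2 * (M : ℝ) + 2), Γ.c3Of a L C₁ C₂, Γ.c5Of C₁ C₂, by positivity,
    MinConsts.c3Of_nonneg hΓ ha hL.2 hC₁.le hC₂.le, MinConsts.c5Of_nonneg hΓ hC₁.le hC₂.le, ?_⟩
  intro Q hQd hQL hQa hR hRr hκ hsm m2 hm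
  subst hQd hQL hQa hΓμ hΓε
  have hΓ'v : (Γ.toConsts (Γ.c3Of Q.a Q.L C₁ C₂) (Γ.c5Of C₁ C₂)).Valid :=
    MinConsts.toConsts_valid hΓ (MinConsts.c3Of_nonneg hΓ ha hL.2 hC₁.le hC₂.le) (MinConsts.c5Of_nonneg hΓ hC₁.le hC₂.le)
  obtain ⟨γ₀, Cc, hγ, hCc, h1⟩ := ineq329Printed_thresholds Q hL.2 ha hd2 hd3 hκ _ hΓ'v hsm hm
  refine ⟨γ₀, Cc, hγ, hCc, fun ij hri => ?_⟩
  obtain ⟨i, j⟩ := ij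
  exact h1 ⟨i.toRMultiP (Γ.c3Of Q.a Q.L C₁ C₂) (Γ.c5Of C₁ C₂), j⟩
    (RMultiMR.restricted_toRMultiP hΓ ha pkg hδ hC₂.le hR hRr i hri)

/-! ## §4 The constructor from the large-field data: regions, cut-offs and their hypotheses DERIVED -/

section Constructor

/-- The radii of the regions tower in lattice units of `T^{(j)}`: `r(Lʲε)` at every level with `Lʲε ≤ 1` (all `j ≤ K`); the mesh is capped at `1`
so that the typer's `towerOf` gets a nonnegative radius at every `j : ℕ` (levels above `K` are empty and unused). [cite: Balaban1982Higgs2, (2.7) p.558, (2.43) p.566] -/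
def towerRad (Q : B2.Params) (P : HiggsLattice.Params) (j : ℕ) : ℝ := B2.rFn Q.R Q.r (min (P.mesh j) 1)

/-- `towerRad = r(Lʲε)` when `Lʲε ≤ 1`. [cite: Balaban1982Higgs2, (2.7) p.558] -/
theorem towerRad_eq {Q : B2.Params} {P : HiggsLattice.Params} {j : ℕ} (h : P.mesh j ≤ 1) :
    towerRad Q P j = B2.rFn Q.R Q.r (P.mesh j) := by
  rw [towerRad, min_eq_left h]

/-- `R ≤ towerRad` (`R, r ≥ 0`; the capped mesh lies in `(0, 1]`). [cite: Balaban1982Higgs2, (2.7) p.558] -/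
theorem le_towerRad {Q : B2.Params} (hR : 0 ≤ Q.R) (hr : 0 ≤ Q.r) (P : HiggsLattice.Params) (j : ℕ) : Q.R ≤ towerRad Q P j :=
  le_rFn hR hr (lt_min (P.mesh_pos j) zero_lt_one) (min_le_right _ _)

/-- `towerRad ≥ 0` (`R, r ≥ 0`). [cite: Balaban1982Higgs2, (2.7) p.558] -/
theorem towerRad_nonneg {Q : B2.Params} (hR : 0 ≤ Q.R) (hr : 0 ≤ Q.r) (P : HiggsLattice.Params) : ∀ j, 0 ≤ towerRad Q P j :=
  fun j => hR.trans (le_towerRad hR hr P j)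

/-- **The regions tower of the instance**: the typer's `towerOf` — `Λ₅^{(j)} := towerRegion bad r j 5` built by (2.7)–(2.8) from the
large-field points `bad j` of each step with radius `r(Lʲε)`, *"Λ₅^{(K)} = ∅"* (radii nonnegative by the printed largeness `R ≥ (L/3)(2M + 8)`,
`r ≥ 1`). [cite: Balaban1982Higgs2, (2.43) p.566, (3.22)–(3.23) p.588] -/
def dataTower (Q : B2.Params) (P : HiggsLattice.Params) (hR : (P.L : ℝ) / 3 * (2 * (P.M : ℝ) + 8) ≤ Q.R) (hr : 1 ≤ Q.r)
    (bad : (j : ℕ) → Set (HiggsLattice.Site P j)) (K : ℕ) : Tower P K :=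
  towerOf bad (towerRad Q P) (towerRad_nonneg (R_pos_of hR).le (zero_le_one.trans hr) P) K

/-- **The `Λ₁`-regions of the instance**: at level `k = l + 1`, `(near Λ₀^{(l)} r(Lˡε))′ ⊆ Λ₋₁^{(l)′}` — the coarse sites whose whole block is
within `< r(Lˡε)` of `Λ₀^{(l)}` (where (2.55) holds, p. 570); `∅` at level `0`. [cite: Balaban1982Higgs2, (2.55) p.570, (2.9) p.558] -/
def L1Of (Q : B2.Params) (P : HiggsLattice.Params) (bad : (j : ℕ) → Set (HiggsLattice.Site P j)) :
    (k : ℕ) → Finset (HiggsLattice.Site P k)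
  | 0 => ∅
  | l + 1 => prime (near (towerRegion bad (towerRad Q P) l 0) (towerRad Q P l))

/-- **The `Λ₂`-regions of the instance**: at level `k = l + 1`, `(Λ₂^{(l)})′` (where Lemma 2.3 concludes, p. 571); `∅` at level `0`.
[cite: Balaban1982Higgs2, Lemma 2.3 p.571, (2.8) p.558] -/
def L2Of (Q : B2.Params) (P : HiggsLattice.Params) (bad : (j : ℕ) → Set (HiggsLattice.Site P j)) :
    (k : ℕ) → Finset (HiggsLattice.Site P k)
  | 0 => ∅
  | l + 1 => prime (towerRegion bad (towerRad Q P) l 2)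

/-- **THE REMAINING DATA of an instance whose regions and cut-offs are CONSTRUCTED**: a torus of the sub-family with large-block factor `M`,
steps `K ≤` the lattice's with `Lᴷε ≤ ε₀ ≤ 1`, the printed largeness of (2.7) in the explicit form `R ≥ (L/3)(2M + 8)`, `r ≥ 1` (so `ρ_k ≥ 6`,
`r(·) > 0`), the large-field points `bad j` of every step (decided by the characteristic functions (2.4)–(2.6)/(2.53) — data), the charge data,
the cut-offs `θ_k` with their printed properties RELATIVE TO THE CONSTRUCTED TOWER, `A₀`, the block fields `A_k`, the configuration `Φ`, and the
inclusion of the `θ_{j+2}`-slice in `Bʲ⁺²((Λ₂^{(j+1)})′)` (p. 567). [cite: Balaban1982Higgs2, Prop. 3.1 p.589, (2.43) p.566, p.567, (3.2) p.583, (3.24) p.588] -/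
structure RegionsData (Q : B2.Params) (Γ : MinConsts) (M : ℕ) (m2 : ℝ) where
  P : HiggsLattice.Params
  hL : P.L = Q.L
  hd : P.d = Q.d
  hM : P.M = M
  S : Shape P
  N : ℕ
  K : ℕ
  hK : K ≤ P.K
  hε₀ : P.mesh K ≤ Γ.ε₀
  hmesh1 : P.mesh K ≤ 1
  /-- *"R > R₀"* of (2.7), explicit: `R ≥ (L/3)(2M + 8)` -/
  hR : (P.L : ℝ) / 3 * (2 * (P.M : ℝ) + 8) ≤ Q.R
  /-- *"r > 1"* of (2.7) (here `≥ 1`) -/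
  hr : 1 ≤ Q.r
  /-- the large-field points of step `j + 1`, on `T₁^{(j)}` -/
  bad : (j : ℕ) → Set (HiggsLattice.Site P j)
  C : ChargeData N
  hCe : C.e = Γ.e
  θ : ℕ → HiggsLattice.Site P 0 → ℝ
  θ_nested : Nested θ
  θ_range : ∀ m (z : HiggsLattice.Site P 0), 0 ≤ θ m z ∧ θ m z ≤ 1
  θ_one : ∀ k, 1 ≤ k → k ≤ K → ∀ z : HiggsLattice.Site P 0,
    (dataTower Q P hR hr bad K).lamAt (k - 1) z →
      θ k z = 1 ∧ ∀ ν, θ k (z.shift ν) = 1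
  θ_zero : ∀ k, k + 2 ≤ K → ∀ z : HiggsLattice.Site P 0, (θ (k + 2) z ≠ 0 ∨ ∃ ν, θ (k + 2) (z.shift ν) ≠ 0) →
    (dataTower Q P hR hr bad K).lamAt k z
  θ_above : ∀ m, K < m → ∀ z : HiggsLattice.Site P 0, θ m z = 0
  θ_lip : ∀ k (z : HiggsLattice.Site P 0) (ν : Fin P.d), |θ (k + 1) (z.shift ν) - θ (k + 1) z| ≤ Γ.cθ * ((P.L : ℝ) ^ k)⁻¹
  A₀ : HiggsLattice.VecField P 0
  Ac : (k : ℕ) → HiggsLattice.VecField P k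
  Φ : Cfg (dataTower Q P hR hr bad K).regions N
  /-- the `θ_{j+2}`-slice lies within `Bʲ⁺²((Λ₂^{(j+1)})′)` -/
  slice_sub : ∀ j (z : HiggsLattice.Site P 0) (ν : Fin P.d),
    (θ (j + 2) z ≠ 0 ∨ θ (j + 2) (z.shift ν) ≠ 0) → blockIter (j + 2) z ∈ L2Of Q P bad (j + 2)

namespace RegionsData

variable {Q : B2.Params} {Γ : MinConsts} {M : ℕ} {m2 : ℝ}

/-- `R ≥ 0` for the data. [cite: Balaban1982Higgs2, (2.7) p.558] -/
theorem hR0 (D : RegionsData Q Γ M m2) : 0 ≤ Q.R := (R_pos_of D.hR).le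

/-- `r ≥ 0` for the data. [cite: Balaban1982Higgs2, (2.7) p.558] -/
theorem hr0 (D : RegionsData Q Γ M m2) : 0 ≤ Q.r := zero_le_one.trans D.hr

/-- The tower of the data (abbreviation). [cite: Balaban1982Higgs2, (3.22) p.588] -/
def tower (D : RegionsData Q Γ M m2) : Tower D.P D.K := dataTower Q D.P D.hR D.hr D.bad D.K

/-- `s_k ≤ 1` for `k ≤ K`. [cite: Balaban1982Higgs2, p.582] -/
theorem mesh_le_one (D : RegionsData Q Γ M m2) {k : ℕ} (hk : k ≤ D.K) : D.P.mesh k ≤ 1 := (mesh_le_mesh hk).trans D.hmesh1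

/-- **THE INSTANCE BUILT FROM THE DATA**: regions `Λ₅^{(j)}` = the constructed tower, `Λ₁`/`Λ₂`-regions = `L1Of`/`L2Of`, cut-offs
`ζ^{(k)} := zeta244 k ρ_k` — with `ζ_abs`/`ζ_supp`/`ζ_one`/`ζ_lip` (`B2Eq244Cutoff`), `L2_sub` (`Λ₂ ⊆ Λ₀ ⊆` its neighbourhood), `nbhd`
(`B2Eq28RegionsCollars.nbhd_radC`: the three (2.8)-collars) and `lam_sub` (`Λ₅ ⊆ Λ₂`) PROVED. [cite: Balaban1982Higgs2, Prop. 3.1 p.589, (2.44) p.566, (2.8) p.558, Lemma 2.3 p.571] -/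
def toRMultiMR (D : RegionsData Q Γ M m2) : RMultiMR Q Γ M m2 where
  P := D.P
  hL := D.hL
  hd := D.hd
  hM := D.hM
  S := D.S
  N := D.N
  K := D.K
  hK := D.hK
  hε₀ := D.hε₀
  T := D.tower
  C := D.C
  hCe := D.hCe
  θ := D.θ
  θ_nested := D.θ_nested
  θ_range := D.θ_range
  θ_one := D.θ_one
  θ_zero := D.θ_zero
  θ_above := D.θ_above
  θ_lip := D.θ_lip
  A₀ := D.A₀
  Ac := D.Ac
  Φ := D.Φ
  ζ k := zeta244 D.P k (radC Q.R Q.r D.P k)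
  ζ_abs k _ _ x y' := abs_zeta244_le_one _ x y'
  ζ_supp k _ hk x y' h := zeta244_supp (hk.trans D.hK) h
  ζ_one k hk1 hk x y' h := by
    have h6 : 6 ≤ radC Q.R Q.r D.P k := six_le_radC hk1 (D.mesh_le_one hk) D.hR D.hr
    exact zeta244_eq_one (hk.trans D.hK) (by linarith) h
  ζ_lip k _ _ x ν y' := zeta244_lip _ x ν y'
  L1 := L1Of Q D.P D.bad
  L2 := L2Of Q D.P D.bad
  L2_sub k := by
    cases k with
    | zero => exact Finset.Subset.refl _
    | succ l => exact prime_towerRegion_two_subset (lt_of_lt_of_le (R_pos_of D.hR) (le_towerRad D.hR0 D.hr0 D.P l))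
  nbhd k hk1 hk x y' hx hd := by
    obtain ⟨l, rfl⟩ : ∃ l, k = l + 1 := ⟨k - 1, by omega⟩
    have hl1 : D.P.mesh l ≤ 1 := D.mesh_le_one ((Nat.le_succ l).trans hk)
    have hpos : 0 < B2.rFn Q.R Q.r (D.P.mesh l) := rFn_pos_of D.hR D.hr0 (D.P.mesh_pos l) hl1
    exact nbhd_radC (hk.trans D.hK) (towerRad_eq hl1) hpos x y' hx hd
  lam_sub j hj := prime_lam_subset (towerRad_nonneg D.hR0 D.hr0 D.P) hj
  slice_sub := D.slice_sub

/-- The instance lives on the data's torus (definitional). [cite: Balaban1982Higgs1, (1.2) p.604] -/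
theorem toRMultiMR_P (D : RegionsData Q Γ M m2) : D.toRMultiMR.P = D.P := rfl

/-- Its number of steps (definitional). [cite: Balaban1982Higgs2, p.582] -/
theorem toRMultiMR_K (D : RegionsData Q Γ M m2) : D.toRMultiMR.K = D.K := rfl

/-- Its cut-offs are `zeta244` at the radius (c) (definitional). [cite: Balaban1982Higgs2, (2.44) p.566] -/
theorem toRMultiMR_ζ (D : RegionsData Q Γ M m2) (k : ℕ) : D.toRMultiMR.ζ k = zeta244 D.P k (radC Q.R Q.r D.P k) := rfl

/-- Its `Λ₁`-region at level `l + 1` is `(near Λ₀^{(l)} r(Lˡε))′` (definitional). [cite: Balaban1982Higgs2, (2.55) p.570] -/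
theorem toRMultiMR_L1_succ (D : RegionsData Q Γ M m2) (l : ℕ) :
    D.toRMultiMR.L1 (l + 1) = prime (near (towerRegion D.bad (towerRad Q D.P) l 0) (towerRad Q D.P l)) := rfl

/-- Its `Λ₂`-region at level `l + 1` is `(Λ₂^{(l)})′` (definitional). [cite: Balaban1982Higgs2, Lemma 2.3 p.571] -/
theorem toRMultiMR_L2_succ (D : RegionsData Q Γ M m2) (l : ℕ) :
    D.toRMultiMR.L2 (l + 1) = prime (towerRegion D.bad (towerRad Q D.P) l 2) := rfl

/-- **WHAT `restricted` MEANS FOR THE CONSTRUCTED INSTANCE** (unfolding, with the level-`0` clauses vacuous): (2.55)₂ on `(near Λ₀^{(k−1)} r)′`,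
(2.55)₁ integrated for `y ∈ (Λ₂^{(k−1)})′`, `y′ ∈ (near Λ₀^{(k−1)} r)′`, (2.17) on the `θ`-slices, (2.55)₄ on `Λ_k` — restrictions on the block fields
only, over the PRINTED regions. [cite: Balaban1982Higgs2, Prop. 3.1 p.589, (2.55) p.570, (2.17) p.560, (3.15) p.586] -/
theorem toRMultiMR_restrictedM_iff (D : RegionsData Q Γ M m2) :
    D.toRMultiMR.restrictedM ↔
      (∀ l, l + 1 ≤ D.K → ∀ y' ∈ prime (near (towerRegion D.bad (towerRad Q D.P) l 0) (towerRad Q D.P l)),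
          ‖toSite (D.Ac (l + 1)) y'‖ ≤ Γ.thrA D.P.d (D.P.mesh (l + 1)))
      ∧ (∀ l, l + 1 ≤ D.K → ∀ y ∈ prime (towerRegion D.bad (towerRad Q D.P) l 2),
          ∀ y' ∈ prime (near (towerRegion D.bad (towerRad Q D.P) l 0) (towerRad Q D.P l)),
          ‖toSite (D.Ac (l + 1)) y' - toSite (D.Ac (l + 1)) y‖
            ≤ Γ.thrQ D.P.d (D.P.mesh (l + 1)) * (Γ.r₁ + Γ.r₂ * (HiggsLattice.Site.tdist y y' : ℝ)))
      ∧ (∀ (j : Fin D.K), ∀ z ∈ pieceF D.tower.regions j, ∀ μ ν : Fin D.P.d,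
          (D.θ (j.val + 2) z ≠ 0 ∨ D.θ (j.val + 2) (z.shift ν) ≠ 0) →
          |D.Ac (j.val + 2) ⟨blockIter (j.val + 2) z, μ⟩ - D.Ac (j.val + 1) ⟨blockIter (j.val + 1) z, μ⟩|
            ≤ Γ.thr217M D.P.d (D.P.mesh (j.val + 1)))
      ∧ (∀ (j : Fin D.K) (y : LSite D.tower.regions j), ‖resL D.tower.regions j D.Φ y‖ ≤ Γ.thrφM D.P.d (D.P.mesh (j.val + 1))) := by
  unfold RMultiMR.restrictedM
  refine and_congr ?_ (and_congr ?_ Iff.rfl)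
  · constructor
    · intro h l hl y' hy'
      exact h (l + 1) (Nat.succ_le_succ (Nat.zero_le l)) hl y' hy'
    · intro h k hk1 hk y' hy'
      obtain ⟨l, rfl⟩ : ∃ l, k = l + 1 := ⟨k - 1, by omega⟩
      exact h l hk y' hy'
  · constructor
    · intro h l hl y hy y' hy'
      exact h (l + 1) (Nat.succ_le_succ (Nat.zero_le l)) hl y hy y' hy'
    · intro h k hk1 hk y hy y' hy'
      obtain ⟨l, rfl⟩ : ∃ l, k = l + 1 := ⟨k - 1, by omega⟩
      exact h l hk y hy y' hy'

end RegionsData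

end Constructor

/-! ## §5 Non-vacuity of the data at `K = 1`, for every large-field datum -/

section NonVacuity

variable {Q : B2.Params} {Γ : MinConsts} {M : ℕ} {m2 : ℝ}

/-- **A ONE-STEP DATUM FOR EVERY TORUS AND EVERY LARGE-FIELD CONFIGURATION**: on a torus `P` of the sub-family (`P.L = Q.L`, `P.d = Q.d`, `P.M = M`,
`P.K ≥ 1`, `Lε ≤ ε₀ ≤ 1`) with `R ≥ (L/3)(2M + 8)`, `r ≥ 1`, valid `Γ`, ANY large-field points `bad`: `K = 1`, `θ₁ ≡ 1` (gen 12's `thetaW`; the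
slice clauses are then vacuous), `A₀ = 0`, block fields `A_k ≡ v`, `Φ = 0`. [cite: Balaban1982Higgs2, Prop. 3.1 p.589, (3.2) p.583, p.567, (2.43) p.566] -/
def regionsDataW (hΓ : Γ.Valid) (hR : (Q.L : ℝ) / 3 * (2 * (M : ℝ) + 8) ≤ Q.R) (hr : 1 ≤ Q.r) (P : HiggsLattice.Params) (S : Shape P)
    (hPL : P.L = Q.L) (hPd : P.d = Q.d) (hPM : P.M = M) (hK1 : 1 ≤ P.K) (hε₀ : P.mesh 1 ≤ Γ.ε₀)
    (bad : (j : ℕ) → Set (HiggsLattice.Site P j)) (v : EuclideanSpace ℝ (Fin P.d)) : RegionsData Q Γ M m2 where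
  P := P
  hL := hPL
  hd := hPd
  hM := hPM
  S := S
  N := 1
  K := 1
  hK := hK1
  hε₀ := hε₀
  hmesh1 := hε₀.trans hΓ.ε₀_le_one
  hR := by rw [hPL, hPM]; exact hR
  hr := hr
  bad := bad
  C := chargeW Γ.e
  hCe := rfl
  θ := thetaW P
  θ_nested := nested_thetaW
  θ_range m z := by
    by_cases hm : m = 1
    · subst hm; rw [thetaW_one]; norm_num
    · rw [thetaW_of_ne hm]; norm_num
  θ_one k hk1 hkK z _ := by
    obtain rfl : k = 1 := by omega
    exact ⟨thetaW_one z, fun ν => thetaW_one _⟩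
  θ_zero k hk z _ := by omega
  θ_above m hm z := thetaW_of_ne (by omega) z
  θ_lip k z ν := by
    have h0 : thetaW P (k + 1) (z.shift ν) - thetaW P (k + 1) z = 0 := by
      by_cases hk : k + 1 = 1
      · rw [hk, thetaW_one, thetaW_one, sub_self]
      · rw [thetaW_of_ne hk, thetaW_of_ne hk, sub_self]
    rw [h0, abs_zero]
    exact mul_nonneg hΓ.cθ_nonneg (inv_nonneg.2 (pow_nonneg (Nat.cast_nonneg _) _))
  A₀ := 0
  Ac k := ofSite (fun _ : HiggsLattice.Site P k => v)
  Φ := 0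
  slice_sub j z ν hsl := by
    exfalso
    have hj : j + 2 ≠ 1 := by omega
    rcases hsl with h | h
    · exact h (thetaW_of_ne hj z)
    · exact h (thetaW_of_ne (P := P) hj (z.shift ν))

/-- **THE ONE-STEP DATUM IS RESTRICTED** as soon as the constant block field obeys (2.55)₂ at scale `Lε`, `‖v‖ ≤ c_{A1}(Lε)^{−d/2}p(Lε)` (the
variation of a constant is `0`, the (2.17) slice clause is vacuous, `Φ = 0` meets (2.55)₄) — for EVERY large-field datum `bad` (the regions
only shrink the sets over which the clauses are asked). [cite: Balaban1982Higgs2, Prop. 3.1 p.589, (2.55) p.570, (2.17) p.560, (3.15) p.586] -/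
theorem regionsDataW_restrictedM (hΓ : Γ.Valid) (hR : (Q.L : ℝ) / 3 * (2 * (M : ℝ) + 8) ≤ Q.R) (hr : 1 ≤ Q.r)
    (P : HiggsLattice.Params) (S : Shape P) (hPL : P.L = Q.L) (hPd : P.d = Q.d) (hPM : P.M = M) (hK1 : 1 ≤ P.K)
    (hε₀ : P.mesh 1 ≤ Γ.ε₀) (bad : (j : ℕ) → Set (HiggsLattice.Site P j)) {v : EuclideanSpace ℝ (Fin P.d)}
    (hv : ‖v‖ ≤ Γ.thrA P.d (P.mesh 1)) :
    (regionsDataW (m2 := m2) hΓ hR hr P S hPL hPd hPM hK1 hε₀ bad v).toRMultiMR.restrictedM := by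
  have hs1 : P.mesh 1 ≤ 1 := hε₀.trans hΓ.ε₀_le_one
  refine ⟨?_, ?_, ?_, ?_⟩
  · intro k hk1 hk y' _
    change k ≤ 1 at hk
    obtain rfl : k = 1 := le_antisymm hk hk1
    show ‖toSite (ofSite fun _ : HiggsLattice.Site P 1 => v) y'‖ ≤ Γ.thrA P.d (P.mesh 1)
    rw [toSite_ofSite]
    exact hv
  · intro k hk1 hk y _ y' _
    change k ≤ 1 at hk
    obtain rfl : k = 1 := le_antisymm hk hk1
    show ‖toSite (ofSite fun _ : HiggsLattice.Site P 1 => v) y' - toSite (ofSite fun _ : HiggsLattice.Site P 1 => v) y‖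
      ≤ Γ.thrQ P.d (P.mesh 1) * (Γ.r₁ + Γ.r₂ * (HiggsLattice.Site.tdist y y' : ℝ))
    rw [toSite_ofSite, sub_self, norm_zero]
    have h1 := thrQ_nonneg hΓ (P.mesh_pos 1) hs1 P.d
    have h2 := hΓ.r₁_nonneg
    have h3 := hΓ.r₂_nonneg
    positivity
  · intro j z _ μ ν hsl
    exfalso
    have hj : j.val + 2 ≠ 1 := by omega
    rcases hsl with h | h
    · exact h (thetaW_of_ne hj z)
    · exact h (thetaW_of_ne (P := P) hj (z.shift ν))
  · intro j y
    show ‖(0 : V 1)‖ ≤ _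
    rw [norm_zero]
    have hj : j.val = 0 := by
      have h := j.isLt
      change j.val < 1 at h
      omega
    have hsj : 0 < P.mesh (j.val + 1) ∧ P.mesh (j.val + 1) ≤ 1 := by rw [hj]; exact ⟨P.mesh_pos 1, hs1⟩
    unfold MinConsts.thrφM
    have hp : 0 ≤ B2.pFn Γ.b₀ Γ.p (P.mesh (j.val + 1)) :=
      pFn_nonneg' (Γ := Γ.toConsts 0 0) (MinConsts.toConsts_valid hΓ le_rfl le_rfl) hsj.1 hsj.2
    have := hΓ.cφ_nonneg
    have := hΓ.lam_pos
    have : 0 ≤ Γ.lam ^ (-(1 / 4 : ℝ)) := Real.rpow_nonneg hΓ.lam_pos.le _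
    have : 0 ≤ P.mesh (j.val + 1) ^ (-(P.d : ℝ) / 4) := Real.rpow_nonneg hsj.1.le _
    positivity

end NonVacuity

end Literature.MathematicalPhysics.QuantumFieldTheory.Balaban1983to89.B2Prop31MinimizerRegions

end
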